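import Mathlib
import Summits.MatrixMultiplication.MatrixMultiplication.Theses.ThinBlockAlpha
import Summits.MatrixMultiplication.MatrixMultiplication.Theorems.ThinBlockAlphaRectangularThmBChartSTPP
import Summits.MatrixMultiplication.MatrixMultiplication.Theorems.ThinBlockAlphaRectangularThmBGrowth
import Summits.MatrixMultiplication.MatrixMultiplication.Theorems.RectangularThmB.Negative.NullChart
import Summits.MatrixMultiplication.MatrixMultiplication.Theorems.RectangularThmB.Negative.NullChartEntropy
import Summits.MatrixMultiplication.MatrixMultiplication.Theorems.RectangularThmB.Negative.LoadBearing
import Summits.MatrixMultiplication.MatrixMultiplication.Theorems.ThinBlockAlphaBoundedExponentTwoSevenths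
import Literature.Computability.AlgebraicComplexity.LaserMethodTypeCount

/-!
# REFUTATION of crux `RectangularThmB` (stmt-MatrixMultiplication-10597, route ThinBlockAlpha)

`not_RectangularThmB : ¬ ThinBlockAlpha.RectangularThmB` — the "rectangular Theorem B" is FALSE.
(Dependency-drift repair 2026-08-17: the refuted decl was dropped from the gate-rendered route file at rev 6,
2026-08-16T08:57Z, as settled negative knowledge; it is RECORDED verbatim under its original fully-qualified name
in `Theorems/RectangularThmB/Negative/LoadBearing.lean`, now imported, so the refutation keeps its text and
proof; the construction lemma `exists_thin_family`, re-landed meanwhile as `twoSevenths_thin_family`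
(`Theorems/ThinBlockAlphaBoundedExponentTwoSevenths.lean`), is kept as a deprecated alias of that copy.)

Construction (null-offset CKSU chart over `ℤ/9`, side-finding of the crux-triage of the twin item
stmt-10596, re-derived and formalised by the line lead of this crux). Symbols `a = (F, {0}, {1})`,
`b = ({0}, ℤ/9 ∖ {0,8}, {0})`, `c = ({0}, {0}, F)`, `o = ({0}, {0}, {1})`, `F = ℤ/9 ∖ {0,1}`
(`Negative.NullChart`: per-symbol TPP and TRAPPING by `decide` — every solvable coordinate pattern has
Farkas value `[x ∈ {a,b}] + [y ∈ {b,c}] + (−1,−2,−1,0)(z) ≥ 0`, and value `0` only on patterns whose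
profile `(Q₁ x, Q₂ y, Q₃ z)` is the profile of a symbol, `Q₁ = {a,b}|{c,o}`, `Q₂ = {a,o}|{b,c}`,
`Q₃ = {a,c}|{b}|{o}`).  For `n = 18 m` feed the tree's PROVED hashing/type-count theorem
`exists_free_diagonal_jointType_card` (BCS Thm 15.39 + Salem–Spencer/Behrend + types) with the support
`S` of symbol profiles, the joint type `(7m, 2m, 7m, 2m)`, the `b`-tight labels `α = (0,1)`, `β = (1,0)`,
`γ = (−1,0,−2)` and the entropy data of `Negative.NullChartEntropy` (marginal entropies `1, 1, h₀`,
`h₀ = log₂ 9 − (7/9) log₂ 7`, penalty `0`): it returns a free diagonal `Δ` of profile-word triples with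
`|Δ| ≥ 2^{n h₀ − o(n)}`.  Reading each triple as ONE word over the four symbols gives `|Δ|` rows of
composition `(7m, 2m, 7m, 2m)`; three rows not all equal cannot have all coordinate patterns solvable
(Farkas: the values are `≥ 0` and sum to `0` over equal compositions, so all vanish, so all profiles lie
in `S`, so freeness forces the three triples to coincide) — a local chart-USP, hence (CKSU Thm 37,
`stub_chartSTPP`) an STPP family in `(ℤ/9)ⁿ` (exponent `9`) of `L = |Δ|` blocks
`⟨7^{7m}, 7^{2m}, 7^{7m}⟩`, i.e. `a = 2/7`, with `L · N² = |Δ| · 7^{14m} ≥ 9^{18m} · 2^{−o(m)}`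
(`2^{18 m h₀} · 7^{14 m} = 9^{18 m}` exactly).  Since the loss is subexponential (`stub_growth`),
`L · N^{2+η} ≥ 9^{18m} = |H|` for `m` large, contradicting `Inner 9 (2/7) η` — for EVERY `η > 0`.

Consequences: the crux is refuted SUBSTANTIVELY (an asymptotic bounded-exponent abelian STPP certificate
of `ω(1, 2/7, 1) = 2`; no side-condition repair: the family has `N ≥ 2`, `M = N^{2/7}`, exponent `9`);
the twin crux `BoundedExponentThird` (a = 1/3) is untouched (at `ℓ = 9` the chart reaches only `a = 2/7`).
-/

-- `Summit.<Summit>.<Problem>` is the tree's mandated summit-side namespace; for this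
-- single-conjunct summit the two coincide, so the file silences `dupNamespace`.
set_option linter.dupNamespace false

noncomputable section

open Finset

namespace Summit.MatrixMultiplication.MatrixMultiplication.Theorems

open Literature.Computability.AlgebraicComplexity
open Summit.MatrixMultiplication.MatrixMultiplication.Theses.ThinBlockAlpha
open Summit.MatrixMultiplication.MatrixMultiplication.Theorems.RectangularThmB.Negative

/-! ### The construction and the refutation -/

/-- **The thin family** — deprecated spelling. For `η` and `m ≥ 1` large enough that the hashing loss is
below `(7^{7m})^η`, there is an STPP family in `(ℤ/9)^{18m}` of `L` blocks `⟨7^{7m}, 7^{2m}, 7^{7m}⟩` with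
`9^{18m} ≤ L · (7^{7m})^{2+η}`. The identical theorem (same statement, same proof) was re-landed as
`twoSevenths_thin_family` in `Theorems/ThinBlockAlphaBoundedExponentTwoSevenths.lean` while this module was
out of the build (2026-08-16, after the route dropped the refuted decl); the gate's dedup rule forbids carrying
both copies, and Theorems files are append-only, so the name is kept as a deprecated alias of that theorem
(dependency-drift repair 2026-08-17). -/
@[deprecated twoSevenths_thin_family (since := "2026-08-17")]
alias exists_thin_family := twoSevenths_thin_family

/-- **The crux `RectangularThmB` is false.** -/
theorem not_RectangularThmB : ¬ RectangularThmB := by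
  intro h
  obtain ⟨η, hη, hI⟩ := h 9 (2 / 7) (by norm_num) (by norm_num)
  obtain ⟨m, hm, hgrowth⟩ := stub_growth η hη
  obtain ⟨L, A, B, C, hS, hc, hbig⟩ := twoSevenths_thin_family η m hm hgrowth
  have key := hI (Fin (18 * m) → ZMod 9) (exponent_pi_zmod9_le _) L (7 ^ (7 * m)) (7 ^ (2 * m))
    A B C hS hc (le_trans (by norm_num : 2 ≤ 7 ^ 1) (Nat.pow_le_pow_right (by norm_num) (by omega))) ?_
  · have hH : (Fintype.card (Fin (18 * m) → ZMod 9) : ℝ) = (9 : ℝ) ^ (18 * m) := by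
      rw [Fintype.card_fun, ZMod.card, Fintype.card_fin]; push_cast; ring
    rw [hH] at key
    push_cast at key
    linarith
  · -- N^{2/7} ≤ M
    push_cast
    rw [← Real.rpow_natCast (7 : ℝ) (7 * m), ← Real.rpow_mul (by norm_num),
      ← Real.rpow_natCast (7 : ℝ) (2 * m)]
    apply le_of_eq
    congr 1
    push_cast
    ring

end Summit.MatrixMultiplication.MatrixMultiplication.Theorems
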